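import Literature.MathematicalPhysics.QuantumFieldTheory.O2NeutralSectorsHead
import Literature.MathematicalPhysics.QuantumFieldTheory.ConformalBootstrap3D.MixedEvenHead
import HarnessLib

/-!
# O(2) `{φ, s, t}` scan: neutral-sector CELL rules from interval tables

[cite: ChesterEtAl2020, §3.1 (functional conditions)] [cite: HogervorstRychkov2013, §3 eqs. (3.6), (3.9)]
[cite: KosPolandSimmonsduffin2014, §3.3 eq. (3.16), §4 eqs. (4.2)–(4.3)] [cite: Hladik2017, Thm. 1]

WHAT THIS FILE DOES (engines lane SDP-4, O(2) client path; Lean side only).  `O2NeutralSectorsHead`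
states the sector conditions `0⁺` / `0⁻` of a scan functional at ONE regular `(Δ, ℓ)` from a PSD head
matrix.  A certificate covers `Δ` by CELLS `[a, b]`; on a cell the head-matrix entries
`H_ik(Δ) = Σ_{(n,j) ∈ S} (A_{n,j}(Δ, ℓ)/λ_ℓ) · M_ik(n, j; Δ)` are enclosed UNIFORMLY from two tables:
the interval recursion bounds `A⁻_{n,j} ≤ A_{n,j}(Δ) ≤ A⁺_{n,j}` (`hrCoeffLo/Hi a b ℓ n j`,
`hrCoeff_mem_Icc_interval`, valid on the whole cell strictly above the unitarity bound) and per-term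
entry tables `Φlo_i(n,j) ≤ M_ii`, `|M_ik| ≤ R_ik(n,j)` valid for `Δ ∈ [a, b]` (reader-supplied, from
endpoint evaluations).  Then
* §1 `headCellSumI ℓ a b S (Φlo i) ≤ (λ_ℓ H)_ii` and `|(λ_ℓ H)_ik| ≤ headAbsSumI ℓ a b S (R i k)` on the cell
  (`min(A⁻Φlo, A⁺Φlo) ≤ A·M`, `|A·M| ≤ A⁺R`);
* §2 the `0⁺` CELL RULE: the four sign–radius matrices of `(lo_i = headCellSumI … (Φlo i),
  r_ik = headAbsSumI … (R i k))` PSD and every tail term matrix PSD for `E ∈ [a+n, b+n]` ⇒ the `0⁺` sector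
  form is `≥ 0` on genuine blocks at every REGULAR `Δ ∈ [a, b]` (`sector0pForm_nonneg_on_cell`), hence
  `Pos0p` there, and at EVERY `Δ ∈ [a, b)` by the right-limit clause (`pos0p_on_cell_Ico`);
* §3 the `0⁻` CELL RULE with the closed-form `2 × 2` numbers `X_lo, Y_lo ≥ 0`, `Z_abs² ≤ X_lo Y_lo`
  (`pos0m_on_cell_Ico`).

HONEST SCOPE.  (i) The entry tables `Φlo`, `R` are HYPOTHESES valid on the cell; producing them from
endpoint values (monotonicity of node values of `F^x_∓[𝒫_{E,j}]` in `E`) is the reader's interval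
arithmetic, recorded for single point functionals in `ConformalBootstrap3D.PointKernelInterval` /
`PointCertificateTableLower` and not re-derived here for the 22-node combinations.  (ii) Tail: termwise
PSD for `E` in a unit-length window per `(n, j)` outside `S` is still an infinite family of hypotheses; a
uniform tail bound is a separate file.  (iii) Charged sectors untreated; nothing here decides an instance.
honest framing: shared numerical engines serving client cells; rigour lives in the verifiers; every
published number belongs to a client cell's ledger, not to the engines group.

DECLARATIONS.  No new definitions; theorems only (kind `proof`).

Sources.  Chester–Landry–Liu–Poland–Simmons-Duffin–Su–Vichi, JHEP 06 (2020) 142, §3.1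
(`ChesterEtAl2020`); Hogervorst–Rychkov, Phys. Rev. D 87 (2013) 106004, §3 eqs. (3.6), (3.9)
(`HogervorstRychkov2013`); Kos–Poland–Simmons-Duffin, JHEP 11 (2014) 109, §3.3 eq. (3.16), §4
eqs. (4.2)–(4.3) (`KosPolandSimmonsduffin2014`); Hladík (2017), Thm. 1 (`Hladik2017`).
-/

namespace Literature.MathematicalPhysics.QuantumFieldTheory.O2NeutralSectorsCells

open Finset Set Matrix Filter Topology
open Literature.MathematicalPhysics.QuantumFieldTheory.O2ThreeScalarCrossing
open Literature.MathematicalPhysics.QuantumFieldTheory.O2ThreeScalarSystem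
open Literature.MathematicalPhysics.QuantumFieldTheory.O2OPEScanBridge
open Literature.MathematicalPhysics.QuantumFieldTheory.O2ScanObligations
open Literature.MathematicalPhysics.QuantumFieldTheory.O2NeutralSectorsTermwise
open Literature.MathematicalPhysics.QuantumFieldTheory.O2NeutralSectorsHead
open Literature.Analysis.ValidatedNumerics.ParametricIntervalPosSemidef (signRadMatrix
  posSemidef_of_forall_signRadMatrix posSemidef_symm_fin_two_of_bounds)
open ConformalBootstrap3D (IsConformalBlock3D IsRegularPoint3D unitarityBound3D accidentalDegeneracy3D
  hrCoeff legendreLam InDescendantRange legendreLam_pos hrCoeffLo hrCoeffHi hrCoeff_mem_Icc_interval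
  headCellSumI headAbsSumI min_mul_le_mul_of_bounds eventually_isRegularPoint3D_nhdsGT_of_bound_le)

/-! ### §1 Entry enclosures of the scaled head matrix on a cell -/

/-- Entries of `λ_ℓ • headMatrix0p`: `Σ_{q ∈ S} A_q · M(q)_ik`. [cite: HogervorstRychkov2013, §3 eq. (3.9)] -/
theorem smul_headMatrix0p_apply (F : ScanFunctional) (D : Dims) (Δ : ℝ) (ℓ : ℕ) (S : Finset (ℕ × ℕ))
    (i k : Fin 3) :
    (legendreLam ℓ • headMatrix0p F D Δ ℓ S) i k =
      ∑ q ∈ S, hrCoeff Δ ℓ q.1 q.2 * termMatrix0p F D (Δ + (q.1 : ℝ)) q.2 i k := by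
  have hlam : legendreLam ℓ ≠ 0 := (legendreLam_pos ℓ).ne'
  simp only [headMatrix0p, Matrix.smul_apply, Matrix.sum_apply, smul_eq_mul, Finset.mul_sum]
  exact Finset.sum_congr rfl fun q _ => by rw [← mul_assoc, mul_div_cancel₀ _ hlam]

/-- Entries of `λ_ℓ • headMatrix0m`. [cite: HogervorstRychkov2013, §3 eq. (3.9)] -/
theorem smul_headMatrix0m_apply (F : ScanFunctional) (D : Dims) (Δ : ℝ) (ℓ : ℕ) (S : Finset (ℕ × ℕ))
    (i k : Fin 2) :
    (legendreLam ℓ • headMatrix0m F D Δ ℓ S) i k =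
      ∑ q ∈ S, hrCoeff Δ ℓ q.1 q.2 * termMatrix0m F D (Δ + (q.1 : ℝ)) q.2 i k := by
  have hlam : legendreLam ℓ ≠ 0 := (legendreLam_pos ℓ).ne'
  simp only [headMatrix0m, Matrix.smul_apply, Matrix.sum_apply, smul_eq_mul, Finset.mul_sum]
  exact Finset.sum_congr rfl fun q _ => by rw [← mul_assoc, mul_div_cancel₀ _ hlam]

/-- **Lower table for a weighted sum** (cell `[a, b]` strictly above the unitarity bound): if
`Φlo_q ≤ m_q` then `headCellSumI ℓ a b S Φlo ≤ Σ_{q ∈ S} A_q(Δ) m_q` for `Δ ∈ [a, b]`.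
[cite: HogervorstRychkov2013, §3 eq. (3.9)] -/
theorem headCellSumI_le_sum {ℓ : ℕ} {a b Δ : ℝ} (ha : unitarityBound3D ℓ < a) (hΔ : Δ ∈ Icc a b)
    (S : Finset (ℕ × ℕ)) (Φlo m : ℕ × ℕ → ℝ) (hΦ : ∀ q ∈ S, Φlo q ≤ m q) :
    headCellSumI ℓ a b S Φlo ≤ ∑ q ∈ S, hrCoeff Δ ℓ q.1 q.2 * m q := by
  refine Finset.sum_le_sum fun q hq => ?_
  have hA := hrCoeff_mem_Icc_interval ha hΔ.1 hΔ.2 q.1 q.2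
  exact min_mul_le_mul_of_bounds hA.2.1 hA.2.2 (hA.1.trans hA.2.1) (hΦ q hq)

/-- **Absolute table for a weighted sum**: if `|m_q| ≤ R_q` then
`|Σ_{q ∈ S} A_q(Δ) m_q| ≤ headAbsSumI ℓ a b S R` for `Δ ∈ [a, b]`. [cite: HogervorstRychkov2013, §3 eq. (3.9)] -/
theorem abs_sum_le_headAbsSumI {ℓ : ℕ} {a b Δ : ℝ} (ha : unitarityBound3D ℓ < a) (hΔ : Δ ∈ Icc a b)
    (S : Finset (ℕ × ℕ)) (R m : ℕ × ℕ → ℝ) (hR : ∀ q ∈ S, |m q| ≤ R q) :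
    |∑ q ∈ S, hrCoeff Δ ℓ q.1 q.2 * m q| ≤ headAbsSumI ℓ a b S R := by
  refine (Finset.abs_sum_le_sum_abs _ _).trans (Finset.sum_le_sum fun q hq => ?_)
  have hA := hrCoeff_mem_Icc_interval ha hΔ.1 hΔ.2 q.1 q.2
  have hA0 : 0 ≤ hrCoeff Δ ℓ q.1 q.2 := hA.1.trans hA.2.1
  rw [abs_mul, abs_of_nonneg hA0]
  exact (mul_le_mul_of_nonneg_left (hR q hq) hA0).trans
    (mul_le_mul_of_nonneg_right hA.2.2 ((abs_nonneg _).trans (hR q hq)))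

/-! ### §2 The `0⁺` cell rule -/

/-- **`0⁺` CELL RULE, regular points** (cell `[a, b]` strictly above the unitarity bound): diagonal tables
`Φlo i`, off-diagonal tables `R i k` valid on the cell, the four sign–radius matrices of
`(headCellSumI … (Φlo i), headAbsSumI … (R i k))` PSD, tail term matrices PSD on `E ∈ [a+n, b+n]` ⇒ the
`0⁺` sector form is `≥ 0` on every family of genuine `z`-blocks at every REGULAR `Δ ∈ [a, b]`.
[cite: KosPolandSimmonsduffin2014, §3.3 eq. (3.16)] [cite: Hladik2017, Thm. 1 ((2) ⇒ (1))]
[cite: HogervorstRychkov2013, §3 eqs. (3.6), (3.9)] -/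
theorem sector0pForm_nonneg_on_cell (F : ScanFunctional) (D : Dims) {ℓ : ℕ} {a b : ℝ}
    (ha : unitarityBound3D ℓ < a) (S : Finset (ℕ × ℕ)) (Φlo : Fin 3 → ℕ × ℕ → ℝ)
    (R : Fin 3 → Fin 3 → ℕ × ℕ → ℝ)
    (hΦ : ∀ q ∈ S, ∀ Δ ∈ Icc a b, ∀ i, Φlo i q ≤ termMatrix0p F D (Δ + (q.1 : ℝ)) q.2 i i)
    (hR : ∀ q ∈ S, ∀ Δ ∈ Icc a b, ∀ i k, i ≠ k → |termMatrix0p F D (Δ + (q.1 : ℝ)) q.2 i k| ≤ R i k q)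
    (hvert : ∀ z : Fin 3 → Bool, (signRadMatrix (fun i => headCellSumI ℓ a b S (Φlo i))
      (Matrix.of fun i k => headAbsSumI ℓ a b S (R i k)) z).PosSemidef)
    (htail : ∀ q : ℕ × ℕ, q ∉ S → InDescendantRange ℓ q.1 q.2 →
      ∀ E ∈ Icc (a + q.1) (b + q.1), (termMatrix0p F D E q.2).PosSemidef) :
    ∀ Δ ∈ Icc a b, IsRegularPoint3D Δ ℓ → ∀ G : Label → ℝ → ℝ → ℝ,
      (∀ L ∈ labels0p, IsConformalBlock3D 0 0 Δ ℓ (G L)) → ∀ x₁ x₂ x₃ : ℝ, 0 ≤ sector0pForm F D G x₁ x₂ x₃ := by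
  intro Δ hΔ hreg G hG x₁ x₂ x₃
  have hlt : unitarityBound3D ℓ < Δ := lt_of_lt_of_le ha hΔ.1
  have hlam : 0 < legendreLam ℓ := legendreLam_pos ℓ
  set A := legendreLam ℓ • headMatrix0p F D Δ ℓ S with hAdef
  have hAh : A.IsHermitian := by
    unfold Matrix.IsHermitian
    rw [hAdef, Matrix.conjTranspose_smul, star_trivial, (isHermitian_headMatrix0p F D Δ ℓ S).eq]
  have hApsd : A.PosSemidef := by
    refine posSemidef_of_forall_signRadMatrix hvert hAh (fun i => ?_) (fun i k hik => ?_)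
    · rw [hAdef, smul_headMatrix0p_apply]
      exact headCellSumI_le_sum ha hΔ S (Φlo i) _ fun q hq => hΦ q hq Δ hΔ i
    · rw [Matrix.of_apply, hAdef, smul_headMatrix0p_apply]
      exact abs_sum_le_headAbsSumI ha hΔ S (R i k) _ fun q hq => hR q hq Δ hΔ i k hik
  have hH : headMatrix0p F D Δ ℓ S = (legendreLam ℓ)⁻¹ • A := by
    rw [hAdef, smul_smul, inv_mul_cancel₀ hlam.ne', one_smul]
  have hHpsd : (headMatrix0p F D Δ ℓ S).PosSemidef := by
    rw [hH]
    exact hApsd.smul (inv_nonneg.mpr hlam.le)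
  exact sector0pForm_nonneg_of_headMatrix F D hlt hreg.2 S hHpsd
    (fun q hq hr => htail q hq hr (Δ + (q.1 : ℝ)) ⟨by linarith [hΔ.1], by linarith [hΔ.2]⟩) hG x₁ x₂ x₃

/-- **`0⁺` CELL RULE, half-open cell**: under the hypotheses of `sector0pForm_nonneg_on_cell`, `Pos0p` of
the scan functional at EVERY `Δ ∈ [a, b)` — regular points directly, non-regular points by the limit
clause from the regular points to their right inside the cell.
[cite: KosPolandSimmonsduffin2014, §3.3 eq. (3.16), §4 eqs. (4.2)–(4.3)] [cite: Hladik2017, Thm. 1 ((2) ⇒ (1))]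
[cite: ChesterEtAl2020, §3.1 (functional conditions)] -/
theorem pos0p_on_cell_Ico (F : ScanFunctional) (D : Dims) {ℓ : ℕ} {a b : ℝ}
    (ha : unitarityBound3D ℓ < a) (S : Finset (ℕ × ℕ)) (Φlo : Fin 3 → ℕ × ℕ → ℝ)
    (R : Fin 3 → Fin 3 → ℕ × ℕ → ℝ)
    (hΦ : ∀ q ∈ S, ∀ Δ ∈ Icc a b, ∀ i, Φlo i q ≤ termMatrix0p F D (Δ + (q.1 : ℝ)) q.2 i i)
    (hR : ∀ q ∈ S, ∀ Δ ∈ Icc a b, ∀ i k, i ≠ k → |termMatrix0p F D (Δ + (q.1 : ℝ)) q.2 i k| ≤ R i k q)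
    (hvert : ∀ z : Fin 3 → Bool, (signRadMatrix (fun i => headCellSumI ℓ a b S (Φlo i))
      (Matrix.of fun i k => headAbsSumI ℓ a b S (R i k)) z).PosSemidef)
    (htail : ∀ q : ℕ × ℕ, q ∉ S → InDescendantRange ℓ q.1 q.2 →
      ∀ E ∈ Icc (a + q.1) (b + q.1), (termMatrix0p F D E q.2).PosSemidef) :
    ∀ Δ ∈ Ico a b, Pos0p F.toFunctional D Δ ℓ := by
  intro Δ hΔ
  have hcell := sector0pForm_nonneg_on_cell F D ha S Φlo R hΦ hR hvert htail
  by_cases hr : IsRegularPoint3D Δ ℓ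
  · exact pos0p_of_forall_sector0pForm_nonneg F D fun G hG => hcell Δ ⟨hΔ.1, hΔ.2.le⟩ hr G hG
  · have hbd : unitarityBound3D ℓ ≤ Δ := ha.le.trans hΔ.1
    refine pos0p_of_eventually_right F D hr ?_
    filter_upwards [eventually_isRegularPoint3D_nhdsGT_of_bound_le hbd, Ioo_mem_nhdsGT hΔ.2]
      with Δ' hΔ'reg hΔ'
    exact ⟨hΔ'reg, fun G hG => hcell Δ' ⟨hΔ.1.trans hΔ'.1.le, hΔ'.2.le⟩ hΔ'reg G hG⟩

/-! ### §3 The `0⁻` cell rule -/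

/-- **`0⁻` CELL RULE, regular points** (`2 × 2`, closed-form numbers): tables `Φlo 0, Φlo 1` (diagonal)
and `R` (off-diagonal) valid on the cell; `X_lo = headCellSumI … (Φlo 0) ≥ 0`, `Y_lo = … (Φlo 1) ≥ 0`,
`Z_abs = headAbsSumI … R` with `Z_abs² ≤ X_lo Y_lo`; tail term matrices PSD on `E ∈ [a+n, b+n]` ⇒ the `0⁻`
sector form is `≥ 0` on genuine blocks at every REGULAR `Δ ∈ [a, b]`.
[cite: KosPolandSimmonsduffin2014, §3.3 eq. (3.16)] [cite: HogervorstRychkov2013, §3 eqs. (3.6), (3.9)] -/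
theorem sector0mForm_nonneg_on_cell (F : ScanFunctional) (D : Dims) {ℓ : ℕ} {a b : ℝ}
    (ha : unitarityBound3D ℓ < a) (S : Finset (ℕ × ℕ)) (Φlo : Fin 2 → ℕ × ℕ → ℝ) (R : ℕ × ℕ → ℝ)
    (hΦ : ∀ q ∈ S, ∀ Δ ∈ Icc a b, ∀ i, Φlo i q ≤ termMatrix0m F D (Δ + (q.1 : ℝ)) q.2 i i)
    (hR : ∀ q ∈ S, ∀ Δ ∈ Icc a b, |termMatrix0m F D (Δ + (q.1 : ℝ)) q.2 0 1| ≤ R q)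
    (hX : 0 ≤ headCellSumI ℓ a b S (Φlo 0)) (hY : 0 ≤ headCellSumI ℓ a b S (Φlo 1))
    (hdet : headAbsSumI ℓ a b S R ^ 2 ≤ headCellSumI ℓ a b S (Φlo 0) * headCellSumI ℓ a b S (Φlo 1))
    (htail : ∀ q : ℕ × ℕ, q ∉ S → InDescendantRange ℓ q.1 q.2 →
      ∀ E ∈ Icc (a + q.1) (b + q.1), (termMatrix0m F D E q.2).PosSemidef) :
    ∀ Δ ∈ Icc a b, IsRegularPoint3D Δ ℓ → ∀ G : Label → ℝ → ℝ → ℝ,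
      (∀ L ∈ labels0m, IsConformalBlock3D 0 0 Δ ℓ (G L)) → ∀ x₁ x₂ : ℝ, 0 ≤ sector0mForm F D G x₁ x₂ := by
  intro Δ hΔ hreg G hG x₁ x₂
  have hlt : unitarityBound3D ℓ < Δ := lt_of_lt_of_le ha hΔ.1
  have hlam : 0 < legendreLam ℓ := legendreLam_pos ℓ
  set A := legendreLam ℓ • headMatrix0m F D Δ ℓ S with hAdef
  have hsym : A 1 0 = A 0 1 := by
    have h := (isHermitian_headMatrix0m F D Δ ℓ S).apply 0 1
    rw [star_trivial] at h
    rw [hAdef, Matrix.smul_apply, Matrix.smul_apply, h]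
  have hA2 : A = !![A 0 0, A 0 1; A 0 1, A 1 1] := by
    ext i k; fin_cases i <;> fin_cases k <;> simp [hsym]
  have h11 : headCellSumI ℓ a b S (Φlo 0) ≤ A 0 0 := by
    rw [hAdef, smul_headMatrix0m_apply]
    exact headCellSumI_le_sum ha hΔ S (Φlo 0) _ fun q hq => hΦ q hq Δ hΔ 0
  have h22 : headCellSumI ℓ a b S (Φlo 1) ≤ A 1 1 := by
    rw [hAdef, smul_headMatrix0m_apply]
    exact headCellSumI_le_sum ha hΔ S (Φlo 1) _ fun q hq => hΦ q hq Δ hΔ 1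
  have h12 : |A 0 1| ≤ headAbsSumI ℓ a b S R := by
    rw [hAdef, smul_headMatrix0m_apply]
    exact abs_sum_le_headAbsSumI ha hΔ S R _ fun q hq => hR q hq Δ hΔ
  have hApsd : A.PosSemidef := by
    rw [hA2]
    refine posSemidef_symm_fin_two_of_bounds hX hY ?_ h11 h22 ⟨neg_le_of_abs_le h12, le_of_abs_le h12⟩
    rw [max_le_iff]
    constructor <;> nlinarith [hdet]
  have hH : headMatrix0m F D Δ ℓ S = (legendreLam ℓ)⁻¹ • A := by
    rw [hAdef, smul_smul, inv_mul_cancel₀ hlam.ne', one_smul]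
  have hHpsd : (headMatrix0m F D Δ ℓ S).PosSemidef := by
    rw [hH]
    exact hApsd.smul (inv_nonneg.mpr hlam.le)
  exact sector0mForm_nonneg_of_headMatrix F D hlt hreg.2 S hHpsd
    (fun q hq hr => htail q hq hr (Δ + (q.1 : ℝ)) ⟨by linarith [hΔ.1], by linarith [hΔ.2]⟩) hG x₁ x₂

/-- **`0⁻` CELL RULE, half-open cell**: `Pos0m` at every `Δ ∈ [a, b)`.
[cite: KosPolandSimmonsduffin2014, §3.3 eq. (3.16), §4 eqs. (4.2)–(4.3)] [cite: ChesterEtAl2020, §3.1 (functional conditions)] -/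
theorem pos0m_on_cell_Ico (F : ScanFunctional) (D : Dims) {ℓ : ℕ} {a b : ℝ}
    (ha : unitarityBound3D ℓ < a) (S : Finset (ℕ × ℕ)) (Φlo : Fin 2 → ℕ × ℕ → ℝ) (R : ℕ × ℕ → ℝ)
    (hΦ : ∀ q ∈ S, ∀ Δ ∈ Icc a b, ∀ i, Φlo i q ≤ termMatrix0m F D (Δ + (q.1 : ℝ)) q.2 i i)
    (hR : ∀ q ∈ S, ∀ Δ ∈ Icc a b, |termMatrix0m F D (Δ + (q.1 : ℝ)) q.2 0 1| ≤ R q)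
    (hX : 0 ≤ headCellSumI ℓ a b S (Φlo 0)) (hY : 0 ≤ headCellSumI ℓ a b S (Φlo 1))
    (hdet : headAbsSumI ℓ a b S R ^ 2 ≤ headCellSumI ℓ a b S (Φlo 0) * headCellSumI ℓ a b S (Φlo 1))
    (htail : ∀ q : ℕ × ℕ, q ∉ S → InDescendantRange ℓ q.1 q.2 →
      ∀ E ∈ Icc (a + q.1) (b + q.1), (termMatrix0m F D E q.2).PosSemidef) :
    ∀ Δ ∈ Ico a b, Pos0m F.toFunctional D Δ ℓ := by
  intro Δ hΔ
  have hcell := sector0mForm_nonneg_on_cell F D ha S Φlo R hΦ hR hX hY hdet htail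
  by_cases hr : IsRegularPoint3D Δ ℓ
  · exact pos0m_of_forall_sector0mForm_nonneg F D fun G hG => hcell Δ ⟨hΔ.1, hΔ.2.le⟩ hr G hG
  · have hbd : unitarityBound3D ℓ ≤ Δ := ha.le.trans hΔ.1
    refine pos0m_of_eventually_right F D hr ?_
    filter_upwards [eventually_isRegularPoint3D_nhdsGT_of_bound_le hbd, Ioo_mem_nhdsGT hΔ.2]
      with Δ' hΔ'reg hΔ'
    exact ⟨hΔ'reg, fun G hG => hcell Δ' ⟨hΔ.1.trans hΔ'.1.le, hΔ'.2.le⟩ hΔ'reg G hG⟩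

end Literature.MathematicalPhysics.QuantumFieldTheory.O2NeutralSectorsCells
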